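import Summits.BirchSwinnertonDyer.BirchSwinnertonDyer.Theorems.EdixhovenFibreFiveSevenStarredOptimalManinUnitFiveSevenCdtThm1
import Summits.BirchSwinnertonDyer.BirchSwinnertonDyer.Theses.TeichmullerTwistDescent
import HarnessLib

set_option autoImplicit false
-- the sub-problem namespace `Summit.BirchSwinnertonDyer.BirchSwinnertonDyer` duplicates a component by design (D-0017)
set_option linter.dupNamespace false

/-!
# Crux LOW `SupersingularTorsionOptimalManinUnitFive` (stmt-BirchSwinnertonDyer-23884), closed by name

The low Kosters–Pannekoek cell, shared verbatim by the routes EdixhovenFibreFiveSeven (child of KP57) and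
TeichmullerTwistDescent (crux #3): for `W/ℚ` globally minimal, `(p, ord_p Δ_min) ∈ {(5, 2), (5, 3), (7, 2)}`,
additive at `p`, `E[p]` irreducible, NOT `(G)`-ordinary (potentially supersingular), carrying a `ℚ_p`-rational
point of order `p`, and `D` a lattice-optimal conductor-level datum (`Λ_W = c · Λ_f`): `p ∤ c(D)`.

Only the clauses «additive at `p ≥ 5`» and «lattice-optimal» are used: the landed conditional theorem
`EdixhovenFibreFiveSevenOfCDTInt.not_dvd_c_of_CDTInt` (p811415: `p² ∣ N` at an additive prime, then `|c| = 1` at a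
level with an odd square factor by the integer `c`-division chain
`ManinLocalTwoThree.CDivisionInt.abs_maninConstant_eq_one_of_CDTInt_of_odd_sq_dvd`) takes exactly the printed
Calegari–Dimitrov–Tang Theorem 1.0.1 as hypothesis; that hypothesis is now the tree theorem
`calegariDimitrovTang2025_unboundedDenominators_holds` (p826028, line `cdt_thm1` of crux K★).  The item's decl is
proved in BOTH route namespaces (the two bodies are syntactically identical, hence definitionally equal).

BSD is not proved by this; Manin's conjecture is not proved by this (the statement is one additive cell at
`p ∈ {5, 7}`). [cite: CalegariDimitrovTang2025, Thm. 1.0.1] [cite: KostersPannekoek2017, Thm. 1 and Cor. 2]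
[cite: EdixhovenManin1991, Thm. 3]
-/

namespace Summit.BirchSwinnertonDyer.BirchSwinnertonDyer.Theorems

open Summit.BirchSwinnertonDyer.BirchSwinnertonDyer.Theses

/-- **Crux LOW `SupersingularTorsionOptimalManinUnitFive` (stmt-BirchSwinnertonDyer-23884), proved by name** (route
EdixhovenFibreFiveSeven's decl): on the potentially supersingular torsion cell at `p ∈ {5, 7}` with `E[p]`
irreducible, a `ℚ_p`-rational `p`-torsion point and a lattice-optimal conductor-level datum, `p ∤ c` — from CDT
Theorem 1.0.1 (`calegariDimitrovTang2025_unboundedDenominators_holds`) through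
`EdixhovenFibreFiveSevenOfCDTInt.not_dvd_c_of_CDTInt`; the Kodaira, irreducibility, non-ordinarity and torsion
clauses are idle.  BSD is NOT proved by this. [cite: CalegariDimitrovTang2025, Thm. 1.0.1]
[cite: KostersPannekoek2017, Thm. 1 and Cor. 2] -/
theorem SupersingularTorsionOptimalManinUnitFive_proof :
    EdixhovenFibreFiveSeven.SupersingularTorsionOptimalManinUnitFive := by
  intro W _ _ p _ _ D hp hadd _hirr _hG _htor hlat
  have hp5 : 5 ≤ p := by rcases hp with ⟨rfl, _⟩ | ⟨rfl, _⟩ <;> omega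
  exact EdixhovenFibreFiveSevenOfCDTInt.not_dvd_c_of_CDTInt calegariDimitrovTang2025_unboundedDenominators_holds
    D hp5 hadd hlat

/-- **Crux LOW, route TeichmullerTwistDescent's decl `SupersingularTorsionOptimalManinUnitFive`** (the same item
stmt-BirchSwinnertonDyer-23884; body identical to route EdixhovenFibreFiveSeven's, so the two decls are
definitionally equal) — proved by the EdixhovenFibreFiveSeven-side theorem.  BSD is NOT proved by this.
[cite: CalegariDimitrovTang2025, Thm. 1.0.1] -/
theorem TeichmullerTwistDescent.SupersingularTorsionOptimalManinUnitFive_proof :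
    Theses.TeichmullerTwistDescent.SupersingularTorsionOptimalManinUnitFive :=
  Theorems.SupersingularTorsionOptimalManinUnitFive_proof

end Summit.BirchSwinnertonDyer.BirchSwinnertonDyer.Theorems
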